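import Mathlib
import Summits.Ventures.HodgeRepro.Tier4.Line4.LevelCongruence
import Summits.Ventures.HodgeRepro.Tier4.Line4.TorusFinSplit
import Summits.Ventures.HodgeRepro.Tier4.Line4.LevelSplit
import Summits.Ventures.HodgeRepro.Tier4.Line4.ProductWitness
import Summits.Ventures.HodgeRepro.Tier4.Common.CosetCoveringBound
import Summits.Ventures.HodgeRepro.Tier4.Line1.IntegralWitt

/-!
# Tier4/Line4/ProjSetCompactBound — (F-c): THE UNIFORM PROJECTION BOUND IN THE COMPACT CUT

Blind re-derivation cell `pub-hodge-repro`, Tier 4 «prove the step» (README §9–§10), seat t4-L1-p1 g5 (prover, LINE L4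
chair; the cut (F-c) of plan-4 g6 S15670, crit-1 Entry 196 «the load-bearing statement of (F)»; statement S15737).  Tree
path `lean/Summits/Ventures/HodgeRepro/Tier4/Line4/ProjSetCompactBound.lean`.  Mathlib-level; no literature.

THE STATEMENT.  `S := placesAbove k q`, `T_f ≃ T_S × T_f^{(S)}` (L2-p1's `torusFinSplit`, P1), `Z_S := centreAt W S`
(the elements of `T_S` in the centre `Z`), `B(N) := levelAt W S N` (`T_S ∩ K(N)`), `C ⊆ T_f` compact, Haar measures
`ν_f = c • (ν_S ⊗ ν^{(S)})` (P1's `exists_smul_map_prod_eq_fin`).  There are `c₀ κ : ℕ` such that for every `n > c₀` and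
EVERY `γ ∈ G(𝔸_k)`: `ν_f (C ∩ projSet γ₀ (qⁿ) γ) ≤ c · κ · ν_S ((Z_S ⊓ B(1)) · B(q^{n−c₀})) · ν^{(S)} (π^{(S)} C)` —
UNIFORM in `γ` and `n`: `κ` = the number of `B(1)`-cosets meeting the compact `π_S C` (P4, typer-1's
CosetCoveringBound), `c₀` = P2's congruence constant (L2-p3's `exists_centre_congr_of_mem_projSet`).  The general-`S`
form `…_of_subset` and the re-indexed form `…_reindex` (every exponent, `c₀` absorbed into the level) are included.

THE PROOF (P1 + P2 + P4 with one local lemma).  `projSet γ ⊆ b₀ • projSet x` for a base point `(b₀, b₀′) ∈ suppSet γ`,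
`x := b₀⁻¹ γ_f b₀′ ∈ K(qⁿ) γ₀ K(qⁿ)`; P2: `b ∈ projSet x ⇒ b = z · b₁`, `z ∈ Z_f`, `b₁ ≡ 1 (mod q^{n−c₀})` at every
`v ∣ q`; LOCAL LEMMA `finiteComponent_inv_sub_one_le`: a UNITARY `g` with `g_v ≡ 1 (mod ε)`, `ε ≤ 1`, has `(g⁻¹)_v ≡ 1
(mod ε)` (`det g_v = ±1` from `g B gᵀ = B`, the adjugate is integral — Line1's `IntWitt.inv_mem`); hence the `S`-part
of `b₁` lies in `B(q^{n−c₀})` (`mem_levelK_iff_forall`) and that of `z` in `Z_S`, so `π_S (projSet γ) ⊆ π_S b₀ • (Z_S ·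
B(q^{n−c₀}))`; then `ν_f (C ∩ projSet γ) = c · (ν_S ⊗ ν^{(S)}) (split (C ∩ projSet γ)) ≤ c · ν_S (π_S C ∩ a • (Z_S · B)) ·
ν^{(S)} (π^{(S)} C) ≤ c · κ · ν_S ((Z_S ⊓ B(1)) · B) · ν^{(S)} (π^{(S)} C)` (`measure_inter_smul_mul_le_of_cover`).

Nothing here says anything about the status of the Hodge conjecture for CM abelian varieties, which is NOT proved
(HC_CM is NOT proved by anyone in this repository).
-/

set_option autoImplicit false
noncomputable section
namespace Summit.Ventures.HodgeRepro.Tier4.Line4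
open Summit.Ventures.HodgeRepro.Tier4 Summit.Ventures.HodgeRepro.Tier4.Common Summit.Ventures.HodgeRepro.Tier4.Line1
  NumberField IsDedekindDomain Matrix MeasureTheory
open scoped NumberField Pointwise NNReal ENNReal

section Defs
variable {k : Type} [Field k] [NumberField k] (W : PlaneData k) (S : Set (HeightOneSpectrum (𝓞 k)))

/-- The inclusion `T_S → G(𝔸_k)`. -/
def atInc : torusFinAt W S →* GA W := (finInc W).comp (torusFinAt W S).subtype

/-- `atInc` unfolded. -/
theorem atInc_apply (y : torusFinAt W S) : atInc W S y = (((y : torusFin W) : torusT W) : GA W) := rfl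
/-- **The local centre `Z_S`**: the elements of `T_S` lying in the centre `Z = T ⊓ T′ ⊓ center`. -/
def centreAt : Subgroup (torusFinAt W S) := (centre W).comap (atInc W S)
/-- **The level box `B(N) = T_S ∩ K(N)`** inside `T_S`. -/
def levelAt (N : ℕ) : Subgroup (torusFinAt W S) := (levelK W N).comap (atInc W S)
/-- Membership in `Z_S`. -/
theorem mem_centreAt (y : torusFinAt W S) : y ∈ centreAt W S ↔ atInc W S y ∈ centre W := Iff.rfl
/-- Membership in `B(N)`. -/
theorem mem_levelAt (N : ℕ) (y : torusFinAt W S) : y ∈ levelAt W S N ↔ atInc W S y ∈ levelK W N := Iff.rfl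
end Defs


section Local
variable {k : Type} [Field k] [NumberField k] (W : PlaneData k)

/-- The `v`-component of a unitary `g` satisfies the local unitarity relation `M B_v Mᵀ = B_v`. -/
theorem finiteComponent_mul_B_mul_transpose (v : HeightOneSpectrum (𝓞 k)) (g : GA W) :
    ((GA.finiteComponent W v g : GL (Fin 4) (v.adicCompletion k)) : Matrix (Fin 4) (Fin 4) (v.adicCompletion k)) *
        W.B.map (algebraMap k (v.adicCompletion k)) *
        ((GA.finiteComponent W v g : GL (Fin 4) (v.adicCompletion k)) : Matrix (Fin 4) (Fin 4) (v.adicCompletion k))ᵀ =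
      W.B.map (algebraMap k (v.adicCompletion k)) := by
  have hu : GA.mat W g * adMat k W.B * (GA.mat W g)ᵀ = adMat k W.B := ((mem_unitaryGroup W (g : GL4 k)).1 g.2).2
  have := congrArg (fun M : M4 k => M.map (adComponentFin k v)) hu
  simp only [Matrix.map_mul, Matrix.transpose_map] at this
  rw [map_adMat] at this
  rw [finiteComponent_coe_eq]
  exact this

/-- **The inverse of a unitary element `≡ 1 (mod ε)` at `v` is `≡ 1 (mod ε)` at `v`** (`ε ≤ 1`): `det g_v = ±1`
from the local unitarity relation and `det B ≠ 0`, the adjugate is integral (`IntWitt.inv_mem`), and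
`g_v⁻¹ − 1 = g_v⁻¹ (1 − g_v)`. -/
theorem finiteComponent_inv_sub_one_le (hB : W.B.det ≠ 0) (v : HeightOneSpectrum (𝓞 k)) (g : GA W)
    {ε : WithZero (Multiplicative ℤ)} (hε : ε ≤ 1)
    (h : ∀ i j : Fin 4, Valued.v (((GA.finiteComponent W v g : GL (Fin 4) (v.adicCompletion k)) :
        Matrix (Fin 4) (Fin 4) (v.adicCompletion k)) i j - (1 : Matrix (Fin 4) (Fin 4) (v.adicCompletion k)) i j) ≤ ε)
    (i j : Fin 4) :
    Valued.v (((GA.finiteComponent W v g⁻¹ : GL (Fin 4) (v.adicCompletion k)) :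
        Matrix (Fin 4) (Fin 4) (v.adicCompletion k)) i j - (1 : Matrix (Fin 4) (Fin 4) (v.adicCompletion k)) i j) ≤ ε := by
  set M : Matrix (Fin 4) (Fin 4) (v.adicCompletion k) :=
    ((GA.finiteComponent W v g : GL (Fin 4) (v.adicCompletion k)) : Matrix (Fin 4) (Fin 4) (v.adicCompletion k)) with hM
  set O : ValuationSubring (v.adicCompletion k) := (Valued.v : Valuation (v.adicCompletion k) _).valuationSubring
    with hO
  have hmem : ∀ x : v.adicCompletion k, x ∈ O ↔ Valued.v x ≤ 1 := fun x => Iff.rfl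
  -- the entries of `1` are integral
  have hone : ∀ a b : Fin 4, Valued.v ((1 : Matrix (Fin 4) (Fin 4) (v.adicCompletion k)) a b) ≤ 1 := by
    intro a b
    by_cases hab : a = b
    · subst hab; simp
    · simp [Matrix.one_apply_ne hab]
  -- `M` is integral
  have hMint : ∀ a b, M a b ∈ O := by
    intro a b
    rw [hmem]
    calc Valued.v (M a b) = Valued.v ((M a b - (1 : Matrix (Fin 4) (Fin 4) (v.adicCompletion k)) a b) +
          (1 : Matrix (Fin 4) (Fin 4) (v.adicCompletion k)) a b) := by rw [sub_add_cancel]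
      _ ≤ max (Valued.v (M a b - (1 : Matrix (Fin 4) (Fin 4) (v.adicCompletion k)) a b))
          (Valued.v ((1 : Matrix (Fin 4) (Fin 4) (v.adicCompletion k)) a b)) := Valuation.map_add _ _ _
      _ ≤ 1 := max_le ((h a b).trans hε) (hone a b)
  -- `det M * det M = 1`
  have hBv : (W.B.map (algebraMap k (v.adicCompletion k))).det ≠ 0 := by
    have : (W.B.map (algebraMap k (v.adicCompletion k))).det = algebraMap k (v.adicCompletion k) W.B.det := by
      rw [RingHom.map_det, RingHom.mapMatrix_apply]
    rw [this]
    exact (map_ne_zero _).2 hB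
  have hdet2 : M.det * M.det = 1 := by
    have h1 : M.det * (W.B.map (algebraMap k (v.adicCompletion k))).det * M.det =
        (W.B.map (algebraMap k (v.adicCompletion k))).det := by
      have := congrArg Matrix.det (finiteComponent_mul_B_mul_transpose W v g)
      rw [Matrix.det_mul, Matrix.det_mul, Matrix.det_transpose] at this
      exact this
    have h2 : M.det * M.det * (W.B.map (algebraMap k (v.adicCompletion k))).det =
        1 * (W.B.map (algebraMap k (v.adicCompletion k))).det := by
      rw [one_mul]
      calc M.det * M.det * (W.B.map (algebraMap k (v.adicCompletion k))).det
          = M.det * (W.B.map (algebraMap k (v.adicCompletion k))).det * M.det := by ring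
        _ = (W.B.map (algebraMap k (v.adicCompletion k))).det := h1
    exact mul_right_cancel₀ hBv h2
  have hdet0 : M.det ≠ 0 := fun h0 => by rw [h0, zero_mul] at hdet2; exact zero_ne_one hdet2
  have hdetinv : M.det⁻¹ = M.det := inv_eq_of_mul_eq_one_right hdet2
  have hunit : IntWitt.IsUnitIn O M.det :=
    ⟨hdet0, IntWitt.det_mem hMint, by rw [hdetinv]; exact IntWitt.det_mem hMint⟩
  -- `M⁻¹` is integral
  have hMinv : ∀ a b, Valued.v (M⁻¹ a b) ≤ 1 := fun a b => (hmem _).1 (IntWitt.inv_mem hMint hunit a b)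
  -- the component of `g⁻¹` is `M⁻¹`
  have hcomp : ((GA.finiteComponent W v g⁻¹ : GL (Fin 4) (v.adicCompletion k)) :
      Matrix (Fin 4) (Fin 4) (v.adicCompletion k)) = M⁻¹ := by
    rw [map_inv, hM, Matrix.coe_units_inv]
  -- `M⁻¹ - 1 = M⁻¹ * (1 - M)`
  have hid : M⁻¹ - 1 = M⁻¹ * (1 - M) := by
    rw [Matrix.mul_sub, Matrix.mul_one, Matrix.nonsing_inv_mul M (isUnit_iff_ne_zero.2 hdet0)]
  have hsub : ∀ a b, Valued.v ((1 - M) a b) ≤ ε := by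
    intro a b
    have : (1 - M) a b = -(M a b - (1 : Matrix (Fin 4) (Fin 4) (v.adicCompletion k)) a b) := by
      rw [Matrix.sub_apply, neg_sub]
    rw [this, Valuation.map_neg]
    exact h a b
  rw [hcomp, ← Matrix.sub_apply, hid]
  calc Valued.v ((M⁻¹ * (1 - M)) i j) ≤ 1 * ε := vmul_apply_le v hMinv hsub i j
    _ = ε := one_mul ε

/-- **One-sided congruence at the places of `S` puts the `S`-part in `K(N)`**: if the `v`-components of a unitary `g`
are `≡ 1 (mod N)` at every `v ∈ S`, then `g_S ∈ K(N)` (the inverse side by `finiteComponent_inv_sub_one_le`, the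
places off `S` by triviality of `g_S` there). -/
theorem ofPlacesPart_mem_levelK_of_forall (hB : W.B.det ≠ 0) (S : Set (HeightOneSpectrum (𝓞 k))) (N : ℕ) (g : GA W)
    (h : ∀ v ∈ S, ∀ i j : Fin 4, Valued.v (((GA.finiteComponent W v g : GL (Fin 4) (v.adicCompletion k)) :
        Matrix (Fin 4) (Fin 4) (v.adicCompletion k)) i j - (1 : Matrix (Fin 4) (Fin 4) (v.adicCompletion k)) i j) ≤
        natSize k v N) :
    GA.ofPlacesPart W S g ∈ levelK W N := by
  have key : ∀ g' : GA W, (∀ v ∈ S, ∀ i j : Fin 4, Valued.v (((GA.finiteComponent W v g' :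
      GL (Fin 4) (v.adicCompletion k)) : Matrix (Fin 4) (Fin 4) (v.adicCompletion k)) i j -
      (1 : Matrix (Fin 4) (Fin 4) (v.adicCompletion k)) i j) ≤ natSize k v N) →
      ∀ (i j : Fin 4) (w : HeightOneSpectrum (𝓞 k)),
        Valued.v ((finM k (GA.mat W (GA.ofPlacesPart W S g')) i j - (1 : M4f k) i j) w) ≤ natSize k w N := by
    intro g' hg' i j w
    rw [finM_ofPlacesPart_sub_one_apply]
    split_ifs with hw
    · have : (finM k (GA.mat W g') i j - (1 : M4f k) i j) w =
          ((GA.finiteComponent W w g' : GL (Fin 4) (w.adicCompletion k)) :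
            Matrix (Fin 4) (Fin 4) (w.adicCompletion k)) i j - (1 : Matrix (Fin 4) (Fin 4) (w.adicCompletion k)) i j := by
        rw [fa_sub_apply, finM_apply_apply, one_M4f_apply_apply]
        rfl
      rw [this]
      exact hg' w hw i j
    · simp
  rw [mem_levelK_iff_forall W (ofPlacesPart_mem_finitePart W S g), ← ofPlacesPart_inv]
  exact ⟨key g h, key g⁻¹ fun v hv => finiteComponent_inv_sub_one_le W hB v g (natSize_le_one k v N) (h v hv)⟩

/-- The `S`-part of a central element is central. -/
theorem ofPlacesPart_mem_centre (S : Set (HeightOneSpectrum (𝓞 k))) {z : GA W} (hz : z ∈ centre W) :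
    GA.ofPlacesPart W S z ∈ centre W := by
  refine ⟨⟨ofPlacesPart_mem_torusT W S hz.1.1, ofPlacesPart_mem_torusT' W S hz.1.2⟩, ?_⟩
  show GA.ofPlacesPart W S z ∈ Subgroup.center (GA W)
  rw [Subgroup.mem_center_iff]
  intro h
  have hzc : ∀ h' : GA W, h' * z = z * h' := fun h' => Subgroup.mem_center_iff.1 hz.2 h'
  have hinf : ∀ w : InfinitePlace k, GA.infiniteComponent W w (GA.ofPlacesPart W S z) = 1 :=
    (mem_finitePart W _).1 (ofPlacesPart_mem_finitePart W S z)
  apply GA.ext_of_components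
  · intro w
    rw [map_mul, map_mul, hinf w, one_mul, mul_one]
  · intro w
    by_cases hw : w ∈ S
    · rw [map_mul, map_mul, finiteComponent_ofPlacesPart_of_mem W S hw]
      have := congrArg (GA.finiteComponent W w) (hzc h)
      rw [map_mul, map_mul] at this
      exact this
    · rw [map_mul, map_mul, finiteComponent_ofPlacesPart_of_notMem W S hw, one_mul, mul_one]
end Local

section SplitLemmas
variable {k : Type} [Field k] [NumberField k] (W : PlaneData k) (S : Set (HeightOneSpectrum (𝓞 k)))

/-- `atTf` is multiplicative. -/
theorem atTf_mul (x y : torusFin W) : atTf W S (x * y) = atTf W S x * atTf W S y := by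
  apply Subtype.ext
  apply Subtype.ext
  apply Subtype.ext
  simp only [Subgroup.coe_mul, coe_atTf]
  exact ofPlacesPart_mul W S _ _

/-- The level boxes are antitone in the level. -/
theorem levelAt_antitone {M N : ℕ} (h : M ∣ N) : levelAt W S N ≤ levelAt W S M :=
  Subgroup.comap_mono (levelK_antitone W h)

/-- `B(N)` is open (`N ≠ 0`). -/
theorem isOpen_levelAt {N : ℕ} (hN : N ≠ 0) : IsOpen (levelAt W S N : Set (torusFinAt W S)) := by
  have : (levelAt W S N : Set (torusFinAt W S)) = (torusFinAt W S).subtype ⁻¹' levelTf W N := rfl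
  rw [this]
  exact (isOpen_levelTf W hN).preimage continuous_subtype_val

/-- `projSet γ` is a translate of `projSet x` for the base point `x = b₀⁻¹ γ_f b₀′`. -/
theorem projSet_subset_smul_projSet (γ₀ γ : GA W) (N : ℕ) (b₀ : torusFin W) (b₀' : torusFin' W) :
    projSet W γ₀ N γ ⊆ b₀ • projSet W γ₀ N
      ((((b₀ : torusT W) : GA W))⁻¹ * GA.ofFinPart W γ * ((b₀' : torusT' W) : GA W)) := by
  intro b hb
  obtain ⟨b', hb'⟩ := hb
  have hxf : (((b₀ : torusT W) : GA W))⁻¹ * GA.ofFinPart W γ * ((b₀' : torusT' W) : GA W) ∈ finitePart W :=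
    mul_mem (mul_mem (inv_mem (Subgroup.mem_subgroupOf.1 b₀.2)) (ofFinPart_mem_finitePart W γ))
      (Subgroup.mem_subgroupOf.1 b₀'.2)
  rw [Set.mem_smul_set]
  refine ⟨b₀⁻¹ * b, ⟨b₀'⁻¹ * b', ?_⟩, by simp⟩
  show ((((b₀⁻¹ * b : torusFin W) : torusT W)) : GA W)⁻¹ * GA.ofFinPart W _ *
    ((((b₀'⁻¹ * b' : torusFin' W) : torusT' W)) : GA W) ∈ levelDoubleCoset W N (GA.ofFinPart W γ₀)
  rw [ofFinPart_eq_self_of_mem_finitePart W hxf]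
  have hb'' : (((b : torusT W) : GA W))⁻¹ * GA.ofFinPart W γ * ((b' : torusT' W) : GA W) ∈
      levelDoubleCoset W N (GA.ofFinPart W γ₀) := hb'
  have heq : ((((b₀⁻¹ * b : torusFin W) : torusT W)) : GA W)⁻¹ *
      ((((b₀ : torusT W) : GA W))⁻¹ * GA.ofFinPart W γ * ((b₀' : torusT' W) : GA W)) *
      ((((b₀'⁻¹ * b' : torusFin' W) : torusT' W)) : GA W) =
      (((b : torusT W) : GA W))⁻¹ * GA.ofFinPart W γ * ((b' : torusT' W) : GA W) := by
    simp only [Subgroup.coe_mul, Subgroup.coe_inv]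
    group
  rw [heq]
  exact hb''
end SplitLemmas

section Main
variable {k : Type} [Field k] [NumberField k] (W : PlaneData k)

/-- **(F-c) — THE UNIFORM PROJECTION BOUND IN THE COMPACT CUT** (plan-4 g6 S15670; crit-1 Entry 196): with
`S = placesAbove k q`, `ν_f = c • (ν_S ⊗ ν^{(S)})` along `torusFinSplit` (P1) and `C ⊆ T_f` compact, there are
`c₀ κ : ℕ` with, for every `n > c₀` and every `γ ∈ G(𝔸_k)`,
`ν_f (C ∩ projSet γ₀ (qⁿ) γ) ≤ c · κ · ν_S ((Z_S ⊓ B(1)) · B(q^{n−c₀})) · ν^{(S)} (π^{(S)} C)`. -/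
theorem exists_measure_inter_projSet_le_of_isCompact_of_subset {d : k}
    (hΩ : W.Ω * W.Ω = -(d • (1 : Matrix (Fin 4) (Fin 4) k)))
    (hd : ¬ IsSquare (-d)) (hΩB : W.Ω * W.B = -(W.B * W.Ωᵀ)) (hPB : ∀ i, W.P i * W.B = W.B * (W.P i)ᵀ)
    (hQB : ∀ j, W.Q j * W.B = W.B * (W.Q j)ᵀ) (hPr : ∀ i, (W.P i).rank = 2) (hQr : ∀ j, (W.Q j).rank = 2)
    (hB : W.B.det ≠ 0) (γ₀ : rationalPoints W) (hreg : IsLinRegular W γ₀) (q : ℕ) (hq : q.Prime)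
    (S : Set (HeightOneSpectrum (𝓞 k))) (hS : ∀ v ∈ S, (q : 𝓞 k) ∈ v.asIdeal)
    [MeasurableSpace (torusT W)] [BorelSpace (torusT W)]
    (νf : Measure (torusFin W)) [νf.IsHaarMeasure]
    (νS : Measure (torusFinAt W S)) [νS.IsHaarMeasure]
    (νA : Measure (torusFinAway W S)) [νA.IsHaarMeasure]
    {c : ℝ≥0} (hc : νf = c • Measure.map (torusFinSplit W S).symm (νS.prod νA))
    {C : Set (torusFin W)} (hC : IsCompact C) :
    ∃ c₀ κ : ℕ, ∀ n : ℕ, c₀ < n → ∀ γ : GA W,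
      νf (C ∩ projSet W (γ₀ : GA W) (q ^ n) γ) ≤
        (c : ℝ≥0∞) * ((κ : ℝ≥0∞) *
          νS (((centreAt W S ⊓ levelAt W S 1 : Subgroup _) : Set (torusFinAt W S)) *
            (levelAt W S (q ^ (n - c₀)) : Set (torusFinAt W S))) *
          νA (awayTf W S '' C)) := by
  classical
  -- P2
  obtain ⟨c₀, hc₀⟩ := exists_centre_congr_of_mem_projSet W hΩ hd hΩB hPB hQB hPr hQr hB γ₀ hreg q hq
  -- P4: the finite cover of the compact `π_S C` by cosets of `B(1)`
  haveI := secondCountable_torusFinAt W S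
  haveI := secondCountable_torusFinAway W S
  haveI := locallyCompact_torusFinAway W S
  have hCS : IsCompact (atTf W S '' C) := hC.image (continuous_atTf W S)
  obtain ⟨F, hF⟩ := exists_finset_cover_smul_of_isCompact (levelAt W S 1) (isOpen_levelAt W S one_ne_zero) hCS
  refine ⟨c₀, F.card, fun n hn γ => ?_⟩
  -- measure-theoretic instances
  haveI : BorelSpace (torusFin W) := Subtype.borelSpace _
  haveI : BorelSpace (torusFinAt W S) := Subtype.borelSpace _
  haveI : BorelSpace (torusFinAway W S) := Subtype.borelSpace _
  haveI : BorelSpace (torusFinAt W S × torusFinAway W S) := Prod.borelSpace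
  haveI : SigmaFinite νA := inferInstance
  set Z : Subgroup (torusFinAt W S) := centreAt W S with hZ
  set B₀ : Subgroup (torusFinAt W S) := levelAt W S 1 with hB₀
  set B : Set (torusFinAt W S) := (levelAt W S (q ^ (n - c₀)) : Set (torusFinAt W S)) with hBdef
  have hBB₀ : B ⊆ B₀ := levelAt_antitone W S (one_dvd _)
  -- the measurable equivalence of the split
  set e : torusFin W ≃ᵐ torusFinAt W S × torusFinAway W S :=
    (torusFinSplit W S).toHomeomorph.toMeasurableEquiv with he
  have hfun : (⇑e.symm : torusFinAt W S × torusFinAway W S → torusFin W) = ⇑(torusFinSplit W S).symm := by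
    ext p
    rfl
  have hval : νf (C ∩ projSet W (γ₀ : GA W) (q ^ n) γ) =
      (c : ℝ≥0∞) * (νS.prod νA) (e.symm ⁻¹' (C ∩ projSet W (γ₀ : GA W) (q ^ n) γ)) := by
    rw [hc, Measure.smul_apply, ENNReal.smul_def, smul_eq_mul, ← hfun, MeasurableEquiv.map_apply]
  rw [hval]
  refine mul_le_mul' le_rfl ?_
  -- the empty case
  by_cases hne : (projSet W (γ₀ : GA W) (q ^ n) γ).Nonempty
  swap
  · rw [Set.not_nonempty_iff_eq_empty.1 hne, Set.inter_empty, Set.preimage_empty, measure_empty]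
    exact zero_le
  -- the base point
  obtain ⟨b₀, b₀', hb₀'⟩ := hne
  have hxDC : (((b₀ : torusT W) : GA W))⁻¹ * GA.ofFinPart W γ * ((b₀' : torusT' W) : GA W) ∈
      levelDoubleCoset W (q ^ n) (GA.ofFinPart W (γ₀ : GA W)) := hb₀'
  have hproj := projSet_subset_smul_projSet W (γ₀ : GA W) γ (q ^ n) b₀ b₀'
  -- the `S`-parts lie in the translate of the saturated box
  have hkey : ∀ b ∈ projSet W (γ₀ : GA W) (q ^ n) γ,
      atTf W S b ∈ atTf W S b₀ • ((Z : Set (torusFinAt W S)) * B) := by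
    intro b hb
    obtain ⟨b', hb', hbb⟩ := Set.mem_smul_set.1 (hproj hb)
    obtain ⟨z, hzZ, b₁, hb₁, hcong⟩ := hc₀ n hn _ hxDC b' hb'
    rw [Set.mem_smul_set]
    refine ⟨atTf W S z * atTf W S b₁, Set.mul_mem_mul ?_ ?_, ?_⟩
    · rw [SetLike.mem_coe, hZ, mem_centreAt, atInc_apply, coe_atTf]
      exact ofPlacesPart_mem_centre W S (Subgroup.mem_subgroupOf.1 (Subgroup.mem_subgroupOf.1 hzZ))
    · rw [hBdef, SetLike.mem_coe, mem_levelAt, atInc_apply, coe_atTf]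
      exact ofPlacesPart_mem_levelK_of_forall W hB S _ _ fun v hv => hcong v (hS v hv)
    · rw [smul_eq_mul, ← atTf_mul, ← atTf_mul, ← hb₁, ← smul_eq_mul, hbb]
  -- the product bound
  have hsub : e.symm ⁻¹' (C ∩ projSet W (γ₀ : GA W) (q ^ n) γ) ⊆
      ((atTf W S '' C) ∩ atTf W S b₀ • ((Z : Set (torusFinAt W S)) * B)) ×ˢ (awayTf W S '' C) := by
    intro p hp
    have hp' : e.symm p ∈ C ∩ projSet W (γ₀ : GA W) (q ^ n) γ := hp
    have hpe : p = (atTf W S (e.symm p), awayTf W S (e.symm p)) := by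
      rw [← torusFinSplit_apply]
      exact (e.apply_symm_apply p).symm
    rw [hpe]
    exact ⟨⟨⟨e.symm p, hp'.1, rfl⟩, hkey _ hp'.2⟩, ⟨e.symm p, hp'.1, rfl⟩⟩
  calc (νS.prod νA) (e.symm ⁻¹' (C ∩ projSet W (γ₀ : GA W) (q ^ n) γ))
      ≤ (νS.prod νA) (((atTf W S '' C) ∩ atTf W S b₀ • ((Z : Set (torusFinAt W S)) * B)) ×ˢ
          (awayTf W S '' C)) := measure_mono hsub
    _ = νS ((atTf W S '' C) ∩ atTf W S b₀ • ((Z : Set (torusFinAt W S)) * B)) * νA (awayTf W S '' C) :=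
        Measure.prod_prod _ _
    _ ≤ (F.card : ℝ≥0∞) * νS (((Z ⊓ B₀ : Subgroup (torusFinAt W S)) : Set (torusFinAt W S)) * B) *
          νA (awayTf W S '' C) :=
        mul_le_mul' (measure_inter_smul_mul_le_of_cover νS B₀ Z hBB₀ hF _) le_rfl

/-- **(F-c) at `S = placesAbove k q`** (the level prime's places): the statement of the bus line S15737. -/
theorem exists_measure_inter_projSet_le_of_isCompact {d : k}
    (hΩ : W.Ω * W.Ω = -(d • (1 : Matrix (Fin 4) (Fin 4) k)))
    (hd : ¬ IsSquare (-d)) (hΩB : W.Ω * W.B = -(W.B * W.Ωᵀ)) (hPB : ∀ i, W.P i * W.B = W.B * (W.P i)ᵀ)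
    (hQB : ∀ j, W.Q j * W.B = W.B * (W.Q j)ᵀ) (hPr : ∀ i, (W.P i).rank = 2) (hQr : ∀ j, (W.Q j).rank = 2)
    (hB : W.B.det ≠ 0) (γ₀ : rationalPoints W) (hreg : IsLinRegular W γ₀) (q : ℕ) (hq : q.Prime)
    [MeasurableSpace (torusT W)] [BorelSpace (torusT W)]
    (νf : Measure (torusFin W)) [νf.IsHaarMeasure]
    (νS : Measure (torusFinAt W (placesAbove (k := k) q))) [νS.IsHaarMeasure]
    (νA : Measure (torusFinAway W (placesAbove (k := k) q))) [νA.IsHaarMeasure]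
    {c : ℝ≥0} (hc : νf = c • Measure.map (torusFinSplit W (placesAbove (k := k) q)).symm (νS.prod νA))
    {C : Set (torusFin W)} (hC : IsCompact C) :
    ∃ c₀ κ : ℕ, ∀ n : ℕ, c₀ < n → ∀ γ : GA W,
      νf (C ∩ projSet W (γ₀ : GA W) (q ^ n) γ) ≤
        (c : ℝ≥0∞) * ((κ : ℝ≥0∞) *
          νS (((centreAt W (placesAbove (k := k) q) ⊓ levelAt W (placesAbove (k := k) q) 1 : Subgroup _) :
              Set (torusFinAt W (placesAbove (k := k) q))) *
            (levelAt W (placesAbove (k := k) q) (q ^ (n - c₀)) : Set (torusFinAt W (placesAbove (k := k) q)))) *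
          νA (awayTf W (placesAbove (k := k) q) '' C)) :=
  exists_measure_inter_projSet_le_of_isCompact_of_subset W hΩ hd hΩB hPB hQB hPr hQr hB γ₀ hreg q hq
    (placesAbove (k := k) q) (fun _ hv => hv) νf νS νA hc hC

/-- **(F-c) re-indexed for the glue** (L1-p4 S15774: `hproj` is quantified over EVERY exponent): `c₀` absorbed into the
level, `q ^ (n + c₀ + 1)` on the left and `B(q ^ (n + 1))` on the right, for every `n` and every `γ`. -/
theorem exists_measure_inter_projSet_le_of_isCompact_reindex {d : k}
    (hΩ : W.Ω * W.Ω = -(d • (1 : Matrix (Fin 4) (Fin 4) k)))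
    (hd : ¬ IsSquare (-d)) (hΩB : W.Ω * W.B = -(W.B * W.Ωᵀ)) (hPB : ∀ i, W.P i * W.B = W.B * (W.P i)ᵀ)
    (hQB : ∀ j, W.Q j * W.B = W.B * (W.Q j)ᵀ) (hPr : ∀ i, (W.P i).rank = 2) (hQr : ∀ j, (W.Q j).rank = 2)
    (hB : W.B.det ≠ 0) (γ₀ : rationalPoints W) (hreg : IsLinRegular W γ₀) (q : ℕ) (hq : q.Prime)
    (S : Set (HeightOneSpectrum (𝓞 k))) (hS : ∀ v ∈ S, (q : 𝓞 k) ∈ v.asIdeal)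
    [MeasurableSpace (torusT W)] [BorelSpace (torusT W)]
    (νf : Measure (torusFin W)) [νf.IsHaarMeasure]
    (νS : Measure (torusFinAt W S)) [νS.IsHaarMeasure]
    (νA : Measure (torusFinAway W S)) [νA.IsHaarMeasure]
    {c : ℝ≥0} (hc : νf = c • Measure.map (torusFinSplit W S).symm (νS.prod νA))
    {C : Set (torusFin W)} (hC : IsCompact C) :
    ∃ c₀ κ : ℕ, ∀ (n : ℕ) (γ : GA W),
      νf (C ∩ projSet W (γ₀ : GA W) (q ^ (n + c₀ + 1)) γ) ≤
        (c : ℝ≥0∞) * ((κ : ℝ≥0∞) *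
          νS (((centreAt W S ⊓ levelAt W S 1 : Subgroup _) : Set (torusFinAt W S)) *
            (levelAt W S (q ^ (n + 1)) : Set (torusFinAt W S))) *
          νA (awayTf W S '' C)) := by
  obtain ⟨c₀, κ, h⟩ := exists_measure_inter_projSet_le_of_isCompact_of_subset W hΩ hd hΩB hPB hQB hPr hQr hB γ₀
    hreg q hq S hS νf νS νA hc hC
  refine ⟨c₀, κ, fun n γ => ?_⟩
  have := h (n + c₀ + 1) (by omega) γ
  rwa [show n + c₀ + 1 - c₀ = n + 1 by omega] at this
end Main

end Summit.Ventures.HodgeRepro.Tier4.Line4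

end
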